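import Mathlib

/-!
# Crux `WordLengthQP` (stmt-ValiantsHypothesis-6623), line `Sketch`, stub `stub_sAffine_singular_outer`

In the line's rung-1 model the skeleton letters are `2 × 2` matrices over `ℂ[x̄]` with S-affine
entries (each entry `C a * X v + C b` — affine in ONE variable — or a constant `C b`).  A singular
letter (`det = 0`) CUTS an order-1 program into one live window; this stub supplies the
factorisation the cut consumes: a singular S-affine letter is an outer product
`Matrix.vecMulVec α β` (`(vecMulVec α β) i j = α i * β j`) of two affine vectors ONE OF WHICH IS
CONSTANT.  Proof (rows `(a, b)`, `(c, d)`, `a d = b c` in the UFD `ℂ[x̄]`): if `a = 0` then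
`b c = 0`, so the first row or the first column vanishes; if `a ≠ 0` then `b = C t * a` or
`c = C t * a` (a non-zero constant `a` forces `b` or `c` to be constant since `deg d ≤ 1`; a linear
`a` is prime and divides `b c`, the quotient being constant by degrees), and then `d = C t * c`,
resp. `d = C t * b`, i.e. the columns, resp. rows, are proportional by a constant.
-/

-- `Summit.ValiantsHypothesis.ValiantsHypothesis.…` is the tree's mandated single-conjunct layout
-- (Sub = Summit), so the duplicated namespace component is intended.
set_option linter.dupNamespace false

noncomputable section

open MvPolynomial

namespace Summit.ValiantsHypothesis.ValiantsHypothesis.Cruxes.WordLengthQP.EpsOrderLadder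

/-! ### Degrees and divisibility of affine entries -/

/-- An S-affine entry `C b` or `C a * X v + C b` of `ℂ[x̄]` has total degree `≤ 1`. [folklore] -/
theorem sAffineOuter_totalDegree_le {σ : Type} {p : MvPolynomial σ ℂ}
    (hp : (∃ b : ℂ, p = C b) ∨ (∃ (a b : ℂ) (v : σ), p = C a * X v + C b)) :
    p.totalDegree ≤ 1 := by
  rcases hp with ⟨b, rfl⟩ | ⟨a, b, v, rfl⟩
  · simp
  · refine (totalDegree_add _ _).trans (max_le ((totalDegree_mul _ _).trans ?_) ?_)
    · simp
    · simp

/-- A polynomial of total degree `1` over `ℂ` is prime in the UFD `ℂ[x̄]`: it is irreducible by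
`MvPolynomial.irreducible_of_totalDegree_eq_one` (over a field it is primitive). [folklore] -/
theorem sAffineOuter_prime {σ : Type} {p : MvPolynomial σ ℂ} (hp : p.totalDegree = 1) :
    Prime p := by
  -- adapted from `indgLetters_prime` (Theorems/ElementaryWordLengthWordLengthQPStubIndgLetters)
  have hp0 : p ≠ 0 := by
    rintro rfl
    simp at hp
  refine UniqueFactorizationMonoid.irreducible_iff_prime.mp
    (MvPolynomial.irreducible_of_totalDegree_eq_one hp fun x hx => ?_)
  obtain ⟨i, hi⟩ := exists_coeff_ne_zero hp0
  refine isUnit_iff_ne_zero.mpr ?_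
  rintro rfl
  exact hi (zero_dvd_iff.mp (hx i))

/-- Constant quotients: if `a ≠ 0` divides `b` in `ℂ[x̄]` and `deg b ≤ deg a`, then `b = C t * a`
for a constant `t` (possibly `0`). [folklore] -/
theorem sAffineOuter_dvd_const {σ : Type} {a b : MvPolynomial σ ℂ} (ha0 : a ≠ 0)
    (hdeg : b.totalDegree ≤ a.totalDegree) (h : a ∣ b) : ∃ t : ℂ, b = C t * a := by
  obtain ⟨u, rfl⟩ := h
  by_cases hu0 : u = 0
  · exact ⟨0, by rw [hu0, mul_zero, C_0, zero_mul]⟩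
  · have hmul := totalDegree_mul_of_isDomain ha0 hu0
    have hu : u.totalDegree = 0 := by omega
    rw [totalDegree_eq_zero_iff_eq_C] at hu
    exact ⟨u.coeff 0, by rw [mul_comm, ← hu]⟩

/-- The key dichotomy.  If `a ≠ 0` and `a d = b c` with all four of total degree `≤ 1`, then
`b = C t * a` or `c = C t * a` for a constant `t`: a non-zero constant `a` forces `b` or `c` to be
constant (otherwise `deg (b c) = 2 > deg (a d)`), and a linear `a` is prime, divides `b c`, and the
quotient is constant by degrees. [folklore] -/
theorem sAffineOuter_key {σ : Type} {a b c d : MvPolynomial σ ℂ} (ha0 : a ≠ 0)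
    (ha : a.totalDegree ≤ 1) (hb : b.totalDegree ≤ 1) (hc : c.totalDegree ≤ 1)
    (hd : d.totalDegree ≤ 1) (hdet : a * d = b * c) :
    (∃ t : ℂ, b = C t * a) ∨ (∃ t : ℂ, c = C t * a) := by
  rcases Nat.le_one_iff_eq_zero_or_eq_one.mp ha with ha1 | ha1
  · -- `a = C e` is a non-zero constant
    obtain ⟨e, rfl⟩ : ∃ e : ℂ, a = C e := ⟨_, totalDegree_eq_zero_iff_eq_C.mp ha1⟩
    have he : e ≠ 0 := fun h => ha0 (by rw [h, C_0])
    rcases Nat.le_one_iff_eq_zero_or_eq_one.mp hb with hb1 | hb1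
    · obtain ⟨f, rfl⟩ : ∃ f : ℂ, b = C f := ⟨_, totalDegree_eq_zero_iff_eq_C.mp hb1⟩
      exact Or.inl ⟨f * e⁻¹, by rw [← C_mul, inv_mul_cancel_right₀ he]⟩
    · rcases Nat.le_one_iff_eq_zero_or_eq_one.mp hc with hc1 | hc1
      · obtain ⟨g, rfl⟩ : ∃ g : ℂ, c = C g := ⟨_, totalDegree_eq_zero_iff_eq_C.mp hc1⟩
        exact Or.inr ⟨g * e⁻¹, by rw [← C_mul, inv_mul_cancel_right₀ he]⟩
      · -- `deg b = deg c = 1` contradicts `deg (C e * d) ≤ 1`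
        exfalso
        have hb0 : b ≠ 0 := by
          rintro rfl
          simp at hb1
        have hc0 : c ≠ 0 := by
          rintro rfl
          simp at hc1
        have h2 : (b * c).totalDegree = 2 := by
          rw [totalDegree_mul_of_isDomain hb0 hc0, hb1, hc1]
        have h1 : (C e * d).totalDegree ≤ 1 :=
          (totalDegree_mul _ _).trans (by simpa using hd)
        rw [hdet, h2] at h1
        omega
  · -- `a` is linear, hence prime, and divides `b * c = a * d`
    have hp : Prime a := sAffineOuter_prime ha1
    rcases hp.dvd_or_dvd ⟨d, hdet.symm⟩ with h | h
    · exact Or.inl (sAffineOuter_dvd_const ha0 (hb.trans ha1.ge) h)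
    · exact Or.inr (sAffineOuter_dvd_const ha0 (hc.trans ha1.ge) h)

/-! ### The four explicit outer products -/

/-- Zero first row: `!![0, 0; c, d] = (0, 1) ⊗ (c, d)`. [folklore] -/
theorem sAffineOuter_zeroRow {σ : Type} (c d : MvPolynomial σ ℂ) :
    (!![0, 0; c, d] : Matrix (Fin 2) (Fin 2) (MvPolynomial σ ℂ)) =
      Matrix.vecMulVec ![0, 1] ![c, d] := by
  ext i j
  fin_cases i <;> fin_cases j <;> simp [Matrix.vecMulVec_apply]

/-- Zero first column: `!![0, b; 0, d] = (b, d) ⊗ (0, 1)`. [folklore] -/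
theorem sAffineOuter_zeroCol {σ : Type} (b d : MvPolynomial σ ℂ) :
    (!![0, b; 0, d] : Matrix (Fin 2) (Fin 2) (MvPolynomial σ ℂ)) =
      Matrix.vecMulVec ![b, d] ![0, 1] := by
  ext i j
  fin_cases i <;> fin_cases j <;> simp [Matrix.vecMulVec_apply]

/-- Columns proportional by a constant: `!![a, C t * a; c, C t * c] = (a, c) ⊗ (1, C t)`.
[folklore] -/
theorem sAffineOuter_colProp {σ : Type} (a c : MvPolynomial σ ℂ) (t : ℂ) :
    (!![a, C t * a; c, C t * c] : Matrix (Fin 2) (Fin 2) (MvPolynomial σ ℂ)) =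
      Matrix.vecMulVec ![a, c] ![1, C t] := by
  ext i j
  fin_cases i <;> fin_cases j <;> simp [Matrix.vecMulVec_apply, mul_comm]

/-- Rows proportional by a constant: `!![a, b; C t * a, C t * b] = (1, C t) ⊗ (a, b)`.
[folklore] -/
theorem sAffineOuter_rowProp {σ : Type} (a b : MvPolynomial σ ℂ) (t : ℂ) :
    (!![a, b; C t * a, C t * b] : Matrix (Fin 2) (Fin 2) (MvPolynomial σ ℂ)) =
      Matrix.vecMulVec ![1, C t] ![a, b] := by
  ext i j
  fin_cases i <;> fin_cases j <;> simp [Matrix.vecMulVec_apply]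

/-! ### Assembly -/

/-- Entrywise form of the stub: if `a d - b c = 0` with `a b c d ∈ ℂ[x̄]` of total degree `≤ 1`,
then `!![a, b; c, d]` is an outer product of two affine vectors one of which is constant.
[folklore] -/
theorem sAffineOuter_main {σ : Type} {a b c d : MvPolynomial σ ℂ}
    (ha : a.totalDegree ≤ 1) (hb : b.totalDegree ≤ 1) (hc : c.totalDegree ≤ 1)
    (hd : d.totalDegree ≤ 1) (hdet : a * d - b * c = 0) :
    ∃ α β : Fin 2 → MvPolynomial σ ℂ,
      (!![a, b; c, d] : Matrix (Fin 2) (Fin 2) (MvPolynomial σ ℂ)) = Matrix.vecMulVec α β ∧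
      ((∀ i, ∃ t : ℂ, α i = C t) ∨ (∀ j, ∃ t : ℂ, β j = C t)) ∧
      (∀ i, (α i).totalDegree ≤ 1) ∧ (∀ j, (β j).totalDegree ≤ 1) := by
  have hdet' : a * d = b * c := sub_eq_zero.mp hdet
  by_cases ha0 : a = 0
  · subst ha0
    have hbc : b = 0 ∨ c = 0 := mul_eq_zero.mp (by rw [← hdet', zero_mul])
    rcases hbc with rfl | rfl
    · -- zero first row: `α = (0, 1)` is constant
      refine ⟨![0, 1], ![c, d], sAffineOuter_zeroRow c d, Or.inl ?_, ?_, ?_⟩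
      · intro i
        fin_cases i
        exacts [⟨0, by simp⟩, ⟨1, by simp⟩]
      · intro i
        fin_cases i <;> simp
      · intro j
        fin_cases j
        exacts [by simpa using hc, by simpa using hd]
    · -- zero first column: `β = (0, 1)` is constant
      refine ⟨![b, d], ![0, 1], sAffineOuter_zeroCol b d, Or.inr ?_, ?_, ?_⟩
      · intro j
        fin_cases j
        exacts [⟨0, by simp⟩, ⟨1, by simp⟩]
      · intro i
        fin_cases i
        exacts [by simpa using hb, by simpa using hd]
      · intro j
        fin_cases j <;> simp
  · rcases sAffineOuter_key ha0 ha hb hc hd hdet' with ⟨t, rfl⟩ | ⟨t, rfl⟩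
    · -- `b = C t * a`, hence `d = C t * c`: columns proportional, `β = (1, C t)` constant
      have h1 : a * (d - C t * c) = 0 := by linear_combination hdet'
      have hd' : d = C t * c := sub_eq_zero.mp ((mul_eq_zero.mp h1).resolve_left ha0)
      subst hd'
      refine ⟨![a, c], ![1, C t], sAffineOuter_colProp a c t, Or.inr ?_, ?_, ?_⟩
      · intro j
        fin_cases j
        exacts [⟨1, by simp⟩, ⟨t, by simp⟩]
      · intro i
        fin_cases i
        exacts [by simpa using ha, by simpa using hc]
      · intro j
        fin_cases j <;> simp
    · -- `c = C t * a`, hence `d = C t * b`: rows proportional, `α = (1, C t)` constant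
      have h1 : a * (d - C t * b) = 0 := by linear_combination hdet'
      have hd' : d = C t * b := sub_eq_zero.mp ((mul_eq_zero.mp h1).resolve_left ha0)
      subst hd'
      refine ⟨![1, C t], ![a, b], sAffineOuter_rowProp a b t, Or.inl ?_, ?_, ?_⟩
      · intro i
        fin_cases i
        exacts [⟨1, by simp⟩, ⟨t, by simp⟩]
      · intro i
        fin_cases i <;> simp
      · intro j
        fin_cases j
        exacts [by simpa using ha, by simpa using hb]

/-- **stub_sAffine_singular_outer**: a singular S-affine letter over `ℂ[x̄]` is an outer product
`α βᵀ = Matrix.vecMulVec α β` of two affine vectors ONE OF WHICH IS CONSTANT (UFD: rows or columns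
are proportional by a constant, and `deg αᵢ + deg βⱼ ≤ 1`).  So the boundary data of a window are
an affine vector on one side and a constant vector on the other. [folklore] -/
theorem stub_sAffine_singular_outer {σ : Type} [Fintype σ] [DecidableEq σ]
    (m : Matrix (Fin 2) (Fin 2) (MvPolynomial σ ℂ))
    (hS : ∀ i j : Fin 2, (∃ b : ℂ, m i j = MvPolynomial.C b) ∨
      (∃ (a b : ℂ) (v : σ), m i j = MvPolynomial.C a * MvPolynomial.X v + MvPolynomial.C b))
    (hdet : m.det = 0) :
    ∃ α β : Fin 2 → MvPolynomial σ ℂ, m = Matrix.vecMulVec α β ∧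
      ((∀ i, ∃ c : ℂ, α i = MvPolynomial.C c) ∨ (∀ j, ∃ c : ℂ, β j = MvPolynomial.C c)) ∧
      (∀ i, (α i).totalDegree ≤ 1) ∧ (∀ j, (β j).totalDegree ≤ 1) := by
  have hdeg : ∀ i j : Fin 2, (m i j).totalDegree ≤ 1 := fun i j =>
    sAffineOuter_totalDegree_le (hS i j)
  rw [Matrix.det_fin_two] at hdet
  obtain ⟨α, β, h, hrest⟩ := sAffineOuter_main (hdeg 0 0) (hdeg 0 1) (hdeg 1 0) (hdeg 1 1) hdet
  exact ⟨α, β, (Matrix.eta_fin_two m).trans h, hrest⟩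

end Summit.ValiantsHypothesis.ValiantsHypothesis.Cruxes.WordLengthQP.EpsOrderLadder

end
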